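import Literature.AlgebraicGeometry.Resolution.QuasiSplitNormalFormPair
import Literature.AlgebraicGeometry.Resolution.AlterationsNormalFormBlowupChartsReduction
import Summits.ResolutionOfSingularities.ResolutionOfSingularities.Theorems.WildQuotientsSummitReductionStubPairSsOrbitBlowupLemmas
import HarnessLib

/-!
# `WildQuotients.SummitReduction` (stmt-ResolutionOfSingularities-16324), line `FramePerfect`, stub S
# (`stub_pair_orbitNormalFormBlowup`): the blow-up off the centre, and equivariant strict transforms

Route `ResolutionOfSingularities/WildQuotients`, crux `SummitReduction`; helper file of the line
skeleton (v8), stub S = the orbit version of de Jong 1996, Claim 4.27 for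
`DeJong1997.QuasiSplitNormalFormPair` (de Jong 1997, proof of Prop. 5.11 ¶3: "Thus we blow up in
orbits of components of the singular locus of `X`. The resulting scheme has a local description
as above by the computations of [1, 4.27]").

Everything in Claim 4.27 that does NOT need the chart computation over the centre, for the
coefficient-free equivariant Situation 4.25 (`QuasiSplitNormalFormPair p Z ρ d`) and a blow-up
`π : X' → X` in the reduced ideal sheaf of a closed `C ⊆ Sing X` (step (S3) of the stub off
`π⁻¹(C)`, and the equivariance bookkeeping of the new orbit condition):

* `quasiSplitNormalFormPair_isSNCIdeal_of_notMem`, `quasiSplitNormalFormPair_exists_ringEquiv_of_notMem`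
  — fields 4.25 (i)/(ii) of the structure for `(X', π⁻¹ Z)` at the closed points `x'` with
  `π x' ∉ C`: there `π` is a local isomorphism (`IsBlowup.isIso_morphismRestrict`), the completed
  local rings and the completed ideals of `Z`, `π⁻¹ Z` correspond
  (`map_completedStalkIdeal_vanishingIdeal_preimage`), and `π x'` is a closed point (`π` proper);
* `quasiSplitNormalFormPair_exists_isEffectiveCartier_preimage`, `…_topologicalKrullDim_eq_of_isBlowup`
  — `π⁻¹ Z` is the support of an effective Cartier divisor; `dim X' = d`;
* `singularLocus_eq_biUnion_strictTransformSet_of_overCentre` — [C1] from its part over the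
  centre when the centre `⋃₀ 𝒪` is a union of components of `Sing X`: off `π⁻¹(⋃₀ 𝒪)` a point is
  singular iff its image is, so `Sing X'` is the union of the strict transforms of the components
  `E' ∉ 𝒪` as soon as this holds at the points over the centre;
* `image_strictTransformSet_eq_of_comm`, `iUnion_image_strictTransformSet_eq_of_comm` — for a
  lifted action (`ρ' g ≫ π = π ≫ ρ g`) and a `ρ`-stable centre `C`, `ρ'(g)` carries the strict
  transform of `T` to the strict transform of `ρ(g)(T)`, so the `ρ'`-orbit of a strict transform
  is the strict transform of the `ρ`-orbit (the new orbit-regularity condition upstairs is a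
  statement about strict transforms of orbit closures downstairs).

## Sources

* A. J. de Jong, *Smoothness, semi-stability and alterations*, Publ. Math. IHÉS 83 (1996),
  4.25–4.27, pp. 75–76. [DeJong1996]
* A. J. de Jong, *Families of curves and alterations*, Ann. Inst. Fourier 47 (1997), proof of
  Prop. 5.11, p. 619. [DeJong1997]
-/

set_option linter.dupNamespace false -- the tree's summit namespace repeats `ResolutionOfSingularities`

noncomputable section

open CategoryTheory CategoryTheory.Limits AlgebraicGeometry TopologicalSpace Topology
open Literature.AlgebraicGeometry.Resolution
open Literature.AlgebraicGeometry
open IsLocalRing Scheme.IdealSheafData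

namespace Summit.ResolutionOfSingularities.ResolutionOfSingularities.Theorems

/-! ## The blow-up of a `QuasiSplitNormalFormPair` off the centre -/

section OffCentre

variable {k : Type} [Field k] {X X' : Scheme.{0}} {p : X ⟶ Spec (.of k)} {Z : Set X}
  {G : Type} [Group G] {ρ : G →* Aut X} {d : ℕ} {π : X' ⟶ X}

/-- **`π⁻¹(Z)` is the support of an effective Cartier divisor**: pull back the divisor with
support `Z` along the blow-up (`IsEffectiveCartier.comap_of_isBlowup`).
[cite: DeJong1996, 4.27, p. 76] -/
theorem quasiSplitNormalFormPair_exists_isEffectiveCartier_preimage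
    (h : DeJong1997.QuasiSplitNormalFormPair p Z ρ d) {J : X.IdealSheafData} (hπ : IsBlowup π J) :
    ∃ I : X'.IdealSheafData, IsEffectiveCartier I ∧ (I.support : Set X') = π.base ⁻¹' Z := by
  -- adapted from `NormalFormPair.exists_isEffectiveCartier_preimage` (AlterationsNormalFormBlowupChartsReduction.lean)
  obtain ⟨I, hI, hIZ⟩ := h.exists_isEffectiveCartier
  refine ⟨I.comap π, hI.comap_of_isBlowup hπ, ?_⟩
  rw [support_comap, Closeds.coe_preimage, hIZ]

/-- **`dim X' = d`**: a blow-up in a non-zero ideal sheaf is a modification of the variety `X`.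
[cite: DeJong1996, 2.20 and 4.26, pp. 61, 75] -/
theorem quasiSplitNormalFormPair_topologicalKrullDim_eq_of_isBlowup
    (h : DeJong1997.QuasiSplitNormalFormPair p Z ρ d) {J : X.IdealSheafData} (hJ : J ≠ ⊥)
    (hπ : IsBlowup π J) : topologicalKrullDim X' = d := by
  -- adapted from `NormalFormPair.topologicalKrullDim_eq_of_isBlowup` (AlterationsNormalFormBlowupParts.lean)
  haveI := h.isIntegral
  haveI := h.locallyOfFiniteType
  haveI : IsLocallyNoetherian X := LocallyOfFiniteType.isLocallyNoetherian p
  rw [← h.topologicalKrullDim_eq]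
  exact (IsModification.of_isBlowup hπ hJ).isAlteration.topologicalKrullDim_eq p

/-- **4.25 (i) for `(X', π⁻¹ Z)` at the closed points off the centre**: at a regular closed
point `x' ∈ π⁻¹ Z` with `π x' ∉ C`, the completed ideal of `π⁻¹ Z` has local strict normal
crossings data — transported from `π x'` (a closed point, `π` proper; regular, the stalk map
being an isomorphism) along the isomorphism of completions. [cite: DeJong1996, 4.25–4.27, pp. 75–76] -/
theorem quasiSplitNormalFormPair_isSNCIdeal_of_notMem
    (h : DeJong1997.QuasiSplitNormalFormPair p Z ρ d) (C : Closeds X)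
    (hπ : IsBlowup π (vanishingIdeal C)) {x' : X'} (hx'c : IsClosed ({x'} : Set X'))
    (hreg : IsRegularLocalRing (X'.presheaf.stalk x')) (hx'Z : x' ∈ π.base ⁻¹' Z)
    (hx' : π.base x' ∉ C) (U : X'.affineOpens) (hU : x' ∈ (U : X'.Opens)) :
    IsSNCIdeal (completedStalkIdeal
      (vanishingIdeal ⟨π.base ⁻¹' Z, h.isClosed.preimage π.continuous⟩) x' U hU) := by
  -- adapted from `NormalFormPair.exists_ringEquiv_of_isRegularLocalRing_of_notMem`
  haveI := h.isIntegral
  haveI := h.locallyOfFiniteType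
  haveI : IsNoetherian X := h.isNoetherian
  haveI : IsProper π := hπ.isProper
  haveI : IsIso (π ∣_ ⟨(C : Set X)ᶜ, C.isClosed.isOpen_compl⟩) :=
    DeJong1996.NormalFormPair.isIso_morphismRestrict_compl_of_isBlowup C hπ
  haveI : IsIso (π.stalkMap x') :=
    isIso_stalkMap_of_isIso_morphismRestrict π ⟨(C : Set X)ᶜ, C.isClosed.isOpen_compl⟩ x' hx'
  have hxc : IsClosed ({π.base x'} : Set X) :=
    DeJong1996.NormalFormPair.isClosed_singleton_apply hx'c
  haveI hxreg : IsRegularLocalRing (X.presheaf.stalk (π.base x')) :=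
    IsRegularLocalRing.of_ringEquiv (stalkRingEquivOfIsIso π x').symm
  obtain ⟨U₀, hU₀, hxU₀, -⟩ :=
    exists_isAffineOpen_mem_and_subset (X := X) (x := π.base x') (U := ⊤) (Opens.mem_top _)
  have key := h.isSNCIdeal_completedStalkIdeal (π.base x') hxc hx'Z ⟨U₀, hU₀⟩ hxU₀
  set e := completionEquivOfIsIso π x' with he
  set I' := completedStalkIdeal
    (vanishingIdeal ⟨π.base ⁻¹' Z, h.isClosed.preimage π.continuous⟩) x' U hU with hI'
  have hmap : I'.map e.symm.toRingHom =
      completedStalkIdeal (vanishingIdeal ⟨Z, h.isClosed⟩) (π.base x') ⟨U₀, hU₀⟩ hxU₀ :=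
    map_completedStalkIdeal_vanishingIdeal_preimage π x' ⟨Z, h.isClosed⟩ U hU ⟨U₀, hU₀⟩ hxU₀
  rw [← hmap] at key
  have key' := IsSNCIdeal.of_ringEquiv e key
  rwa [Ideal.map_map, RingEquiv.toRingHom_eq_coe, RingEquiv.comp_symm, Ideal.map_id] at key'

/-- **4.25 (ii) for `(X', π⁻¹ Z)` at the closed points off the centre**, likewise from 4.25
(ii) at `π x'`. [cite: DeJong1996, 4.25–4.27, pp. 75–76] -/
theorem quasiSplitNormalFormPair_exists_ringEquiv_of_notMem
    (h : DeJong1997.QuasiSplitNormalFormPair p Z ρ d) (C : Closeds X)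
    (hπ : IsBlowup π (vanishingIdeal C)) {x' : X'} (hx'c : IsClosed ({x'} : Set X'))
    (hsing : ¬ IsRegularLocalRing (X'.presheaf.stalk x')) (hx' : π.base x' ∉ C) :
    ∃ (A : Type) (_ : CommRing A) (_ : IsRegularLocalRing A) (t : Fin (d - 1) → A) (s r : ℕ),
      Ideal.span (Set.range t) = maximalIdeal A ∧ ringKrullDim A = (d - 1 : ℕ) ∧
      2 ≤ s ∧ s ≤ r ∧ r ≤ d - 1 ∧
      ∃ e : AdicCompletion (maximalIdeal (X'.presheaf.stalk x')) (X'.presheaf.stalk x') ≃+*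
          DeJong1996.NodeDeformationRing A
            (∏ i ∈ Finset.univ.filter (fun i : Fin (d - 1) => i.val < s), t i),
        ∀ (U : X'.affineOpens) (hU : x' ∈ (U : X'.Opens)),
          (completedStalkIdeal (vanishingIdeal ⟨π.base ⁻¹' Z, h.isClosed.preimage π.continuous⟩)
              x' U hU).map e.toRingHom =
            Ideal.span {DeJong1996.NodeDeformationRing.ofBase A _
              (∏ i ∈ Finset.univ.filter (fun i : Fin (d - 1) => i.val < r), t i)} := by
  -- adapted from `NormalFormPair.exists_ringEquiv_of_not_isRegularLocalRing_of_notMem`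
  haveI := h.isIntegral
  haveI := h.locallyOfFiniteType
  haveI : IsNoetherian X := h.isNoetherian
  haveI : IsProper π := hπ.isProper
  haveI : IsIso (π ∣_ ⟨(C : Set X)ᶜ, C.isClosed.isOpen_compl⟩) :=
    DeJong1996.NormalFormPair.isIso_morphismRestrict_compl_of_isBlowup C hπ
  haveI : IsIso (π.stalkMap x') :=
    isIso_stalkMap_of_isIso_morphismRestrict π ⟨(C : Set X)ᶜ, C.isClosed.isOpen_compl⟩ x' hx'
  have hxc : IsClosed ({π.base x'} : Set X) :=
    DeJong1996.NormalFormPair.isClosed_singleton_apply hx'c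
  have hxsing : ¬ IsRegularLocalRing (X.presheaf.stalk (π.base x')) := fun hr =>
    hsing (IsRegularLocalRing.of_ringEquiv (stalkRingEquivOfIsIso π x'))
  obtain ⟨A, _, _, t, s, r, hspan, hdim, hs2, hsr, hrd, e, he⟩ :=
    h.exists_ringEquiv_of_not_isRegularLocalRing (π.base x') hxc hxsing
  refine ⟨A, _, ‹_›, t, s, r, hspan, hdim, hs2, hsr, hrd, (completionEquivOfIsIso π x').symm.trans e,
    fun U hU => ?_⟩
  obtain ⟨U₀, hU₀, hxU₀, -⟩ :=
    exists_isAffineOpen_mem_and_subset (X := X) (x := π.base x') (U := ⊤) (Opens.mem_top _)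
  rw [show ((completionEquivOfIsIso π x').symm.trans e).toRingHom =
      e.toRingHom.comp (completionEquivOfIsIso π x').symm.toRingHom from rfl, ← Ideal.map_map,
    ← he ⟨U₀, hU₀⟩ hxU₀,
    ← map_completedStalkIdeal_vanishingIdeal_preimage π x' ⟨Z, h.isClosed⟩ U hU ⟨U₀, hU₀⟩ hxU₀]
  rfl

end OffCentre

/-! ## The singular locus of the blow-up from its description over the centre -/

/-- **[C1] from its part over the centre, for a centre which is a union of components.** Let
`𝒪` be a family of subsets of `X` with closed union (in the stub: the translates of a component
of the closed singular locus `Sing X`), and `π : X' → X` an isomorphism over `X ∖ ⋃₀ 𝒪`. If at the points `x'` over `⋃₀ 𝒪`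
singularity of `X'` is equivalent to lying on the strict transform of a component `E' ∉ 𝒪`,
then `Sing X'` is the union of these strict transforms: off `π⁻¹(⋃₀ 𝒪)` the local rings of `X'`
are those of `X` (`mem_regularLocus_iff_of_isIso_morphismRestrict`), a singular image point lies
on a component `E'`, necessarily `∉ 𝒪`, and `π⁻¹(E' ∖ ⋃₀ 𝒪) ⊆ Ẽ' ⊆ π⁻¹ E'`.
[cite: DeJong1996, 4.27, p. 75] -/
theorem singularLocus_eq_biUnion_strictTransformSet_of_overCentre {X' X : Scheme.{0}}
    (π : X' ⟶ X) (hS : IsClosed ({x : X | ¬ IsRegularLocalRing (X.presheaf.stalk x)} : Set X))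
    {𝒪 : Set (Set X)} (hC : IsClosed (⋃₀ 𝒪)) [IsIso (π ∣_ ⟨(⋃₀ 𝒪)ᶜ, hC.isOpen_compl⟩)]
    (hover : ∀ x' : X', π.base x' ∈ ⋃₀ 𝒪 →
      (¬ IsRegularLocalRing (X'.presheaf.stalk x') ↔
        ∃ E' ∈ componentsIn ({x : X | ¬ IsRegularLocalRing (X.presheaf.stalk x)} : Set X),
          E' ∉ 𝒪 ∧ x' ∈ strictTransformSet π (⋃₀ 𝒪) E')) :
    ({x : X' | ¬ IsRegularLocalRing (X'.presheaf.stalk x)} : Set X') =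
      ⋃ E' ∈ componentsIn ({x : X | ¬ IsRegularLocalRing (X.presheaf.stalk x)} : Set X) \ 𝒪,
        strictTransformSet π (⋃₀ 𝒪) E' := by
  -- adapted from `DeJong1996NormalFormPairBlowupSingularLocus.of_overCentre` (AlterationsNormalFormBlowupParts.lean)
  ext x'
  simp only [Set.mem_setOf_eq, Set.mem_iUnion, Set.mem_sdiff, exists_prop]
  by_cases hx : π.base x' ∈ ⋃₀ 𝒪
  · rw [hover x' hx]
    exact ⟨fun ⟨E', hE', hne, hx'⟩ => ⟨E', ⟨hE', hne⟩, hx'⟩,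
      fun ⟨E', ⟨hE', hne⟩, hx'⟩ => ⟨E', hE', hne, hx'⟩⟩
  · have hiff := mem_regularLocus_iff_of_isIso_morphismRestrict π ⟨(⋃₀ 𝒪)ᶜ, hC.isOpen_compl⟩ x' hx
    simp only [Scheme.mem_regularLocus] at hiff
    constructor
    · intro hx'
      have hπx : ¬ IsRegularLocalRing (X.presheaf.stalk (π.base x')) := fun hr => hx' (hiff.mpr hr)
      obtain ⟨E', hE', hxE'⟩ := componentsIn.exists_mem
        (S := ({x : X | ¬ IsRegularLocalRing (X.presheaf.stalk x)} : Set X)) hπx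
      have hne : E' ∉ 𝒪 := fun hmem => hx ⟨E', hmem, hxE'⟩
      exact ⟨E', ⟨hE', hne⟩, strictTransformSet.preimage_diff_subset π _ E' ⟨hxE', hx⟩⟩
    · rintro ⟨E', ⟨hE', -⟩, hx'⟩ hreg'
      have hπx : π.base x' ∈ E' :=
        strictTransformSet.subset_preimage π _ (componentsIn.isClosed hS hE') hx'
      exact componentsIn.subset hE' hπx (hiff.mp hreg')

/-! ## Strict transforms under a lifted action -/

section Equivariant

variable {X' X : Scheme.{0}} {G : Type} [Group G] (ρ : G →* Aut X) (ρ' : G →* Aut X')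
  (π : X' ⟶ X) (hπG : ∀ g : G, (ρ' g).hom ≫ π = π ≫ (ρ g).hom)

/-- `ρ'(g⁻¹)` is the inverse of `ρ'(g)` on points. [folklore] -/
theorem apply_inv_apply_of_action (g : G) (x : X') :
    (ρ' g).hom.base ((ρ' g⁻¹).hom.base x) = x := by
  have e1 : (ρ' g⁻¹).hom = (ρ' g).inv := by
    rw [map_inv, CategoryTheory.Aut.Aut_inv_def]
    rfl
  rw [e1]
  simp

include hπG in
/-- `π` intertwines the actions on points: `π (ρ'(g) x') = ρ(g) (π x')`. [folklore] -/
theorem apply_action_eq_of_comm (g : G) (x' : X') :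
    π.base ((ρ' g).hom.base x') = (ρ g).hom.base (π.base x') := by
  rw [← Scheme.Hom.comp_apply, hπG g, Scheme.Hom.comp_apply]

include hπG in
/-- **A lifted action commutes with preimages**: `ρ'(g)(π⁻¹ A) = π⁻¹(ρ(g) A)`. [folklore] -/
theorem image_preimage_eq_preimage_image_of_comm (g : G) (A : Set X) :
    (ρ' g).hom.base '' (π.base ⁻¹' A) = π.base ⁻¹' ((ρ g).hom.base '' A) := by
  ext x'
  constructor
  · rintro ⟨y, hy, rfl⟩
    exact ⟨π.base y, hy, (apply_action_eq_of_comm ρ ρ' π hπG g y).symm⟩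
  · rintro ⟨a, ha, hax⟩
    refine ⟨(ρ' g⁻¹).hom.base x', ?_, apply_inv_apply_of_action ρ' g x'⟩
    show π.base ((ρ' g⁻¹).hom.base x') ∈ A
    rw [apply_action_eq_of_comm ρ ρ' π hπG g⁻¹ x', ← hax, ← Scheme.Hom.comp_apply]
    have e1 : (ρ g).hom ≫ (ρ g⁻¹).hom = 𝟙 X := by
      rw [map_inv, CategoryTheory.Aut.Aut_inv_def]
      exact (ρ g).hom_inv_id
    rw [e1]
    exact ha

include hπG in
/-- **`ρ'(g)` carries the strict transform of `T` to the strict transform of `ρ(g)(T)`** when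
the centre `C` is `ρ`-stable (`ρ'(g)` is a homeomorphism commuting with `π⁻¹` and with `∖ C`).
[cite: DeJong1997, proof of Prop. 5.11, p. 619] -/
theorem image_strictTransformSet_eq_of_comm {C : Set X} (hC : ∀ g : G, (ρ g).hom.base '' C = C)
    (g : G) (T : Set X) :
    (ρ' g).hom.base '' strictTransformSet π C T = strictTransformSet π C ((ρ g).hom.base '' T) := by
  unfold strictTransformSet
  have hinj : Function.Injective (ρ g).hom.base := (Scheme.homeoOfIso (ρ g)).injective
  rw [show (ρ' g).hom.base '' closure (π.base ⁻¹' (T \ C)) =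
      closure ((ρ' g).hom.base '' (π.base ⁻¹' (T \ C))) from
    (Scheme.homeoOfIso (ρ' g)).image_closure _,
    image_preimage_eq_preimage_image_of_comm ρ ρ' π hπG g, Set.image_sdiff hinj, hC g]

include hπG in
/-- **The `ρ'`-orbit of a strict transform is the strict transform of the `ρ`-orbit** (for `G`
finite: a finite union of closures is the closure of the union).
[cite: DeJong1997, proof of Prop. 5.11, p. 619] -/
theorem iUnion_image_strictTransformSet_eq_of_comm [Finite G] {C : Set X}
    (hC : ∀ g : G, (ρ g).hom.base '' C = C) (T : Set X) :
    (⋃ g : G, (ρ' g).hom.base '' strictTransformSet π C T) =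
      strictTransformSet π C (⋃ g : G, (ρ g).hom.base '' T) := by
  simp_rw [image_strictTransformSet_eq_of_comm ρ ρ' π hπG hC]
  unfold strictTransformSet
  rw [Set.iUnion_sdiff, Set.preimage_iUnion, closure_iUnion_of_finite]

include hπG in
/-- The closure of the `ρ'`-orbit of a strict transform is the strict transform of the
`ρ`-orbit (the orbit is already closed). [cite: DeJong1997, proof of Prop. 5.11, p. 619] -/
theorem closure_iUnion_image_strictTransformSet_eq_of_comm [Finite G] {C : Set X}
    (hC : ∀ g : G, (ρ g).hom.base '' C = C) (T : Set X) :
    closure (⋃ g : G, (ρ' g).hom.base '' strictTransformSet π C T) =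
      strictTransformSet π C (⋃ g : G, (ρ g).hom.base '' T) := by
  rw [iUnion_image_strictTransformSet_eq_of_comm ρ ρ' π hπG hC T]
  exact (strictTransformSet.isClosed π C _).closure_eq

end Equivariant

end Summit.ResolutionOfSingularities.ResolutionOfSingularities.Theorems

end
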